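/-
Origin: expansion seat `planner-pub-hodgecm-pv07-g5-0`, handover #1 2026-08-18T12:47:03Z (md5 dfc650551522f19079cb883387cb6572; NEW additive leaf; ZERO import rewrites — imports the installed tree module HodgeCM.PerL34.GenuineThetaInput only; land any time; pv09-g7 GenuineTensorEmbed and my #2/#3 import it) (`HOME/pub-hodgecm-pv07-g5/lean/Pv07g5/GenuineTransfer.lean`, md5 dfc65055, 250 lines);
landed by the gen-8 packager in gate run 30 as `HodgeCM/PerL34/GenuineTransfer.lean` (verbatim).
-/
/-
Copyright: HodgeCM publication cell (pub-hodgecm), DAG node N31 (seam S3, PerL v5 Lemma 4.2(b)) — TRANSFER of the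
torus-side input of the S3 END along an isometric equivariant embedding, and the END restated along an embedding.
Prover seat pub-hodgecm-pv07-g5 (DAG-node prover #07, generation 5), file #1 (HANDOVER #1).  Released under the
package licence.

Imports the tree only (`HodgeCM.PerL34.GenuineThetaInput`, pv09-g5, landed run 27).  Complete proofs, no new axioms,
nothing cited, no hypothesis posited.
-/
import Summits.HodgeConjecture.HodgeCM.PerL34.GenuineThetaInput

/-!
# The torus side of Lemma 4.2(b) transfers along isometric equivariant embeddings

Both kernel S3 ENDs with the torus side discharged — pv09-g6 `exists_compactDomain_thetaLift_ne_zero_genuine_tensor`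
(`⊗′` model, hypothesis `hω : D.ω = rep (admissible …)`) and pv07-g4 `SchrodingerModel.Coeff.exists_compactDomain_
thetaLift_ne_zero_genuine_shift` (concrete `L²(X)` model, `hω : D.ω = rep L (twistChar L χ)`) — identify the doubling
datum's representation `D.ω` with the model representation by an EQUALITY, which forces the datum's space `Sp` to BE
the model space.  A genuine adelic theta datum (LEMMAS §3 D4, the cell's one MODEL residual of seam S3) will not be
typed on the model space; what it can supply is an isometric `Model L`-equivariant EMBEDDING of a torus model into its
own space (tex l. 600 "φ = ⊗_v φ_v": at a non-split place `v` the group `U(1)(L_v)` is compact and one passes to the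
`χ′_v`-isotypic part, on which it acts by a scalar; at a split place the local Weil representation of
`U(1)(L_v) ≅ (L⁺_v)ˣ` on the Schrödinger model is the twisted dilation representation).

This file proves that EVERY torus-side binder of pv09-g5's END `exists_compactDomain_thetaLift_ne_zero_genuine_of_input`
transfers along such an embedding `E : Sp₁ →ₗᵢ[ℂ] Sp₂`, `E (ω₁ g v) = ω₂ g (E v)`:

* §1 (any group): fixed vectors (`hK`), diagonal matrix coefficients, the unit norm;
* §2 (restricted products): the canonical local coefficients `localCoeff` and the pure-tensor product formula `hM`;
* §3 `GenuineThetaInput.map`: the sixteen-field input structure (`VU ↦ E ∘ VU`, `VS ↦ E ∘ VS`, `hiso` by linearity);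
* §4 **the END ALONG AN EMBEDDING** `exists_compactDomain_thetaLift_ne_zero_genuine_of_embedding`: pv09-g5's END for a
  doubling datum `D` on ANY space `Sp` (theta side `GU`, print inputs `P`, strong continuity `hloc` of `D.ω` on `Sp` —
  unchanged), fed by an abstract torus model `(Sp₁, ω₁, φ₁)` carrying `‖φ₁‖ = 1`, `hK`, `hM`, `X : GenuineThetaInput`
  and an isometric equivariant `E : Sp₁ →ₗᵢ[ℂ] Sp` into the datum's space; conclusion for the vector `E φ₁`.

With `Sp₁ :=` pv09-g6's `⊗′` space or pv07-g4/pv13-g4's `L²(X)` and their discharged torus sides, the model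
equality `hω` of the two ENDs is thereby weakened to "`D.ω` contains the model as an isometric equivariant
sub-representation" (file #2 of this seat does the `L²(X)` case by name).  `hloc` does NOT transfer (it quantifies over
every vector of `Sp`) and stays a hypothesis on the datum, as in pv09-g5's END.

ABSOLUTE RULE respected: nothing cited; every hypothesis below is data, a hypothesis of pv09-g5's END passed through
unchanged, or the equivariance equation `hE` of the embedding.
-/

set_option linter.unusedSectionVars false

noncomputable section

open MeasureTheory MeasureTheory.Measure Set Metric Function Complex ComplexConjugate Topology Filter
open scoped RestrictedProduct InnerProductSpace NNReal ENNReal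

namespace HodgeCM.PerL34.PureTensor

open HodgeCM.PerL34.SplitShells HodgeCM.PerL34.AdelicFactorisation HodgeCM.PerL34.RestrictedMeasure
open HodgeCM.PerL34.NoSmallSubgroups HodgeCM.PerL34.EulerFactorisation HodgeCM.PerL34.DiscreteFD
open HodgeCM.PerL34.LocalFactors HodgeCM.PerL34.LocalFactors.DilationModel
open HodgeCM.PerL34.LocalModulus HodgeCM.PerL34.SplitPlaceDilation
open HodgeCM.PerL34.RallisIP HodgeCM.PerL34.Doubling HodgeCM.PerL34.N31d NumberField IsDedekindDomain
open HodgeCM.PerL34.IdelePlaces HodgeCM.PerL34.RestrictedRegroup HodgeCM.PerL34.RestrictedCutout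
open HodgeCM.PerL34.IdelicTorusModel HodgeCM.PerL34.IdelicTorusModel.Genuine

/-! ## §1  Transfer along an isometric equivariant map: any group -/

namespace Transfer

section group

variable {Γ : Type*} [Group Γ]
  {Sp₁ Sp₂ : Type*} [NormedAddCommGroup Sp₁] [InnerProductSpace ℂ Sp₁]
  [NormedAddCommGroup Sp₂] [InnerProductSpace ℂ Sp₂]
  (ω₁ : Γ →* (Sp₁ ≃ₗᵢ[ℂ] Sp₁)) (ω₂ : Γ →* (Sp₂ ≃ₗᵢ[ℂ] Sp₂))
  (E : Sp₁ →ₗᵢ[ℂ] Sp₂) (hE : ∀ (g : Γ) (v : Sp₁), E (ω₁ g v) = ω₂ g (E v))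

include hE

/-- fixed vectors transfer: `ω₁ k φ = φ ⟹ ω₂ k (E φ) = E φ`. -/
theorem map_fixed {φ : Sp₁} {k : Γ} (hk : ω₁ k φ = φ) : ω₂ k (E φ) = E φ := by
  rw [← hE, hk]

/-- fixed vectors of a family transfer (the END's binder `hK`). -/
theorem map_fixed_of_mem {φ : Sp₁} {K : Set Γ} (hK : ∀ k ∈ K, ω₁ k φ = φ) :
    ∀ k ∈ K, ω₂ k (E φ) = E φ :=
  fun k hk => map_fixed ω₁ ω₂ E hE (hK k hk)

/-- diagonal matrix coefficients transfer: `⟪E φ, ω₂ g (E φ)⟫ = ⟪φ, ω₁ g φ⟫`. -/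
theorem inner_map_apply (φ : Sp₁) (g : Γ) : ⟪E φ, ω₂ g (E φ)⟫_ℂ = ⟪φ, ω₁ g φ⟫_ℂ := by
  rw [← hE, LinearIsometry.inner_map_map]

/-- general matrix coefficients transfer: `⟪E ψ, ω₂ g (E φ)⟫ = ⟪ψ, ω₁ g φ⟫`. -/
theorem inner_map_apply₂ (ψ φ : Sp₁) (g : Γ) : ⟪E ψ, ω₂ g (E φ)⟫_ℂ = ⟪ψ, ω₁ g φ⟫_ℂ := by
  rw [← hE, LinearIsometry.inner_map_map]

/-- eigen-equations transfer: `ω₁ g φ = c • φ ⟹ ω₂ g (E φ) = c • E φ`. -/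
theorem map_smul_eq {φ : Sp₁} {g : Γ} {c : ℂ} (h : ω₁ g φ = c • φ) : ω₂ g (E φ) = c • E φ := by
  rw [← hE, h, LinearIsometry.map_smul]

omit hE in
/-- the unit norm transfers. -/
theorem norm_map_eq_one {φ : Sp₁} (hφ : ‖φ‖ = 1) : ‖E φ‖ = 1 := by
  rw [LinearIsometry.norm_map, hφ]

end group

/-! ## §2  Transfer along an isometric equivariant map: restricted products -/

section restricted

universe u v

variable {ι : Type u} {G : ι → Type v} [∀ i, Group (G i)] [DecidableEq ι]
  {Sub : ι → Type*} [∀ i, SetLike (Sub i) (G i)] [∀ i, SubgroupClass (Sub i) (G i)]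
  (B : ∀ i, Sub i)
  {Sp₁ Sp₂ : Type*} [NormedAddCommGroup Sp₁] [InnerProductSpace ℂ Sp₁]
  [NormedAddCommGroup Sp₂] [InnerProductSpace ℂ Sp₂]
  (ω₁ : (Πʳ i, [G i, B i]) →* (Sp₁ ≃ₗᵢ[ℂ] Sp₁)) (ω₂ : (Πʳ i, [G i, B i]) →* (Sp₂ ≃ₗᵢ[ℂ] Sp₂))
  (E : Sp₁ →ₗᵢ[ℂ] Sp₂) (hE : ∀ (g : Πʳ i, [G i, B i]) (v : Sp₁), E (ω₁ g v) = ω₂ g (E v))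

include hE

/-- the canonical local coefficients transfer: `localCoeff ω₂ (E φ) i g = localCoeff ω₁ φ i g`. -/
theorem localCoeff_map (φ : Sp₁) (i : ι) (g : G i) :
    localCoeff B ω₂ (E φ) i g = localCoeff B ω₁ φ i g := by
  simp only [localCoeff, inner_map_apply ω₁ ω₂ E hE]

/-- the pure-tensor product formula transfers (the END's binder `hM`). -/
theorem prodFormula_map (φ : Sp₁) {T : Finset ι}
    (hM : ∀ S : Finset ι, T ⊆ S → ∀ y : (i : ↥S) → G i,
      ⟪φ, ω₁ (extendOne B S y) φ⟫_ℂ = ∏ i : ↥S, localCoeff B ω₁ φ i (y i)) :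
    ∀ S : Finset ι, T ⊆ S → ∀ y : (i : ↥S) → G i,
      ⟪E φ, ω₂ (extendOne B S y) (E φ)⟫_ℂ = ∏ i : ↥S, localCoeff B ω₂ (E φ) i (y i) := by
  intro S hS y
  rw [inner_map_apply ω₁ ω₂ E hE, hM S hS y]
  exact Finset.prod_congr rfl fun i _ => (localCoeff_map B ω₁ ω₂ E hE φ i (y i)).symm

end restricted

end Transfer

/-! ## §3  The input structure transfers -/

namespace GenuineThetaInput

variable {L : Type} [Field L] [NumberField L] [IsCMField L]
  [DecidableEq (Place (maximalRealSubfield L))]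
  [∀ v : HeightOneSpectrum (𝓞 (maximalRealSubfield L)), MeasurableSpace (v.adicCompletion (maximalRealSubfield L))]
  [∀ v : HeightOneSpectrum (𝓞 (maximalRealSubfield L)), BorelSpace (v.adicCompletion (maximalRealSubfield L))]
  {S : Finset (Place (maximalRealSubfield L))}
  {Sp₁ Sp₂ : Type} [NormedAddCommGroup Sp₁] [InnerProductSpace ℂ Sp₁]
  [NormedAddCommGroup Sp₂] [InnerProductSpace ℂ Sp₂]
  {ω₁ : Model L →* (Sp₁ ≃ₗᵢ[ℂ] Sp₁)} {ω₂ : Model L →* (Sp₂ ≃ₗᵢ[ℂ] Sp₂)} {φ : Sp₁} {χ : Model L →* Circle}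

/-- **`GenuineThetaInput` transfers along an isometric equivariant embedding**: the intertwiners are composed with
`E`, the scalar data (`ν`, `x₀`, `r`, `a`) and the character-side fields are unchanged, isotypy by linearity. -/
def map (X : GenuineThetaInput L S Sp₁ ω₁ φ χ) (E : Sp₁ →ₗᵢ[ℂ] Sp₂)
    (hE : ∀ (g : Model L) (v : Sp₁), E (ω₁ g v) = ω₂ g (E v)) :
    GenuineThetaInput L S Sp₂ ω₂ (E φ) χ where
  ν := X.ν
  hν := X.hν
  VU i hi hs := E.comp (X.VU i hi hs)
  hVUψ i hi hs := by
    show E (X.VU i hi hs _) = E φ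
    rw [X.hVUψ i hi hs]
  hVU i hi hs g := by
    show ω₂ _ (E (X.VU i hi hs _)) = E (X.VU i hi hs _)
    rw [← hE, X.hVU i hi hs g]
  x₀ := X.x₀
  r := X.r
  a := X.a
  hr := X.hr
  hr0 := X.hr0
  hνS := X.hνS
  hχS := X.hχS
  VS i hi hs := E.comp (X.VS i hi hs)
  hVSψ i hi hs := by
    show E (X.VS i hi hs _) = E φ
    rw [X.hVSψ i hi hs]
  hVS i hi hs g := by
    show ω₂ _ (E (X.VS i hi hs _)) = E (X.VS i hi hs _)
    rw [← hE, X.hVS i hi hs g]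
  hiso i hi hs g := Transfer.map_smul_eq ω₁ ω₂ E hE (X.hiso i hi hs g)

end GenuineThetaInput

/-! ## §4  The S3 END along an embedding -/

section ofEmbedding

variable (L : Type) [Field L] [NumberField L] [IsCMField L]

variable [DecidableEq (Place (maximalRealSubfield L))]
  [∀ v : HeightOneSpectrum (𝓞 (maximalRealSubfield L)), MeasurableSpace (v.adicCompletion (maximalRealSubfield L))]
  [∀ v : HeightOneSpectrum (𝓞 (maximalRealSubfield L)), BorelSpace (v.adicCompletion (maximalRealSubfield L))]
  (S₀ : Finset (Place (maximalRealSubfield L)))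
  {Sp : Type} [NormedAddCommGroup Sp] [InnerProductSpace ℂ Sp]
  {W : Type} [AddCommGroup W] [Module L W]
  {H Sbox : Type} [Group H] [AddCommGroup Sbox] [Module ℂ Sbox]
  {h : W →ₗ⋆[L] W →ₗ[L] L} (hW : IsLine L W) (hh : Anisotropic h)
  (D : DoublingDatum (Model L) H Sp Sbox) (GU : ThetaSide Sp Sbox)
  (j : isomBox h →* H) (hj : ∀ d : unitary L, j ⟨iotaSnd d, iotaSnd_mem h d⟩ = D.ι (1, unitaryToModel L d))
  (χ : Model L →* Circle) (hχΓ : ∀ d : unitary L, χ (unitaryToModel L d) = 1)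
  (hχVΓ : ∀ d : unitary L, D.χV (unitaryToModel L d) = 1)
  {hP : ∀ Ψ : Sbox, ∀ p ∈ (stabDelta L W).subgroupOf (isomBox h), ∀ x : H,
    D.fSW Ψ (j p * x) = D.fSW Ψ x}
  (P : GluePrintInputs D GU h j hP)
  -- strong continuity of the datum's representation on each local group: a property of `D.ω` on `Sp`, NOT transferable
  (hloc : ∀ (i : Place (maximalRealSubfield L)) (v : Sp),
    Continuous fun g : locTorus (maximalRealSubfield L) L i => D.ω (RestrictedProduct.mulSingle (genLevel L) i g) v)
  {T' : Finset (Place (maximalRealSubfield L))} (hχT' : RestrictedProduct.boxSubgroup (genLevel L) T' ≤ χ.ker)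
  (hlocχ : ∀ i ∈ T', Continuous fun g : locTorus (maximalRealSubfield L) L i => χ (RestrictedProduct.mulSingle (genLevel L) i g))
  -- the TORUS MODEL `(Sp₁, ω₁, φ₁)` with its discharged torus side
  {Sp₁ : Type} [NormedAddCommGroup Sp₁] [InnerProductSpace ℂ Sp₁]
  (ω₁ : Model L →* (Sp₁ ≃ₗᵢ[ℂ] Sp₁)) (φ₁ : Sp₁) (hφ₁ : ‖φ₁‖ = 1)
  {T : Finset (Place (maximalRealSubfield L))} (hK₁ : ∀ k ∈ RestrictedProduct.boxSubgroup (genLevel L) T, ω₁ k φ₁ = φ₁)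
  (hM₁ : ∀ S : Finset (Place (maximalRealSubfield L)), T ⊆ S → ∀ y : (i : ↥S) → locTorus (maximalRealSubfield L) L i,
    inner ℂ φ₁ (ω₁ (extendOne (genLevel L) S y) φ₁) = ∏ i : ↥S, localCoeff (genLevel L) ω₁ φ₁ i (y i))
  {S : Finset (Place (maximalRealSubfield L))} (hTS : T ⊆ S) (hT'S : T' ⊆ S)
  (hS : ∀ v : InfinitePlace (maximalRealSubfield L), Sum.inl v ∈ S)
  (X₁ : GenuineThetaInput L S Sp₁ ω₁ φ₁ χ)
  -- the isometric equivariant EMBEDDING of the torus model into the datum's space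
  (E : Sp₁ →ₗᵢ[ℂ] Sp) (hE : ∀ (g : Model L) (v : Sp₁), E (ω₁ g v) = D.ω g (E v))

include hW hh hj hχΓ hχVΓ P hloc hφ₁ hK₁ hM₁ hTS hT'S hS X₁ hE

set_option synthInstance.maxHeartbeats 200000 in
-- (as in pv09-g5 #1–#4: the `SMul Γ (Model L)` instance behind `IsFundamentalDomain` is slow to find at these types)
/-- **S3 END ALONG AN EMBEDDING.**  pv09-g5's `exists_compactDomain_thetaLift_ne_zero_genuine_of_input` for a doubling
datum `D` on ANY space `Sp`, its torus side fed by a torus model `(Sp₁, ω₁, φ₁)` (unit vector, level `T`, product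
formula, `GenuineThetaInput` at `S`) through an isometric `Model L`-equivariant embedding `E : Sp₁ →ₗᵢ[ℂ] Sp`,
`E ∘ ω₁(g) = D.ω(g) ∘ E`: the genuine theta lift of `E φ₁` paired with `χ` over a compact fundamental domain is
non-zero.  The datum keeps only `hloc` (strong continuity on `Sp`) on the representation side. -/
theorem exists_compactDomain_thetaLift_ne_zero_genuine_of_embedding [IsFiniteMeasure GU.μ] :
    ∃ 𝓕 : Set (Model L), IsCompact 𝓕 ∧ (interior 𝓕).Nonempty ∧ MeasurableSet 𝓕 ∧
      IsFundamentalDomain (unitaryToModel L).range 𝓕 (haarDatum (genLevel L) (isCompact_genLevel L) (isOpen_genLevel L) S₀).μ ∧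
      (haarDatum (genLevel L) (isCompact_genLevel L) (isOpen_genLevel L) S₀).μ 𝓕 ≠ 0 ∧
      (haarDatum (genLevel L) (isCompact_genLevel L) (isOpen_genLevel L) S₀).μ 𝓕 ≠ ⊤ ∧
      ∀ [IsFiniteMeasure (((haarDatum (genLevel L) (isCompact_genLevel L) (isOpen_genLevel L) S₀).μ).restrict 𝓕)]
        (hk : Measurable (Function.uncurry (thetaFn D GU (E φ₁)))) {Ck : ℝ} (hCk : 0 ≤ Ck)
        (hkC : ∀ q u, ‖thetaFn D GU (E φ₁) q u‖ ≤ Ck),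
        PeterssonFubini.theta GU.μ (((haarDatum (genLevel L) (isCompact_genLevel L) (isOpen_genLevel L) S₀).μ).restrict 𝓕) hk
          (measurable_coe_char (genLevel L) (isOpen_genLevel L) χ hχT' hlocχ) hCk hkC (norm_coe_char_le χ) ≠ 0 :=
  exists_compactDomain_thetaLift_ne_zero_genuine_of_input L S₀ hW hh D GU j hj χ hχΓ hχVΓ P (E φ₁)
    (Transfer.norm_map_eq_one E hφ₁) hloc hχT' hlocχ
    (Transfer.map_fixed_of_mem ω₁ D.ω E hE hK₁)
    (Transfer.prodFormula_map (genLevel L) ω₁ D.ω E hE φ₁ hM₁) hTS hT'S hS (X₁.map E hE)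

end ofEmbedding

end HodgeCM.PerL34.PureTensor

end
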